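import Literature.RingTheory.Flat.TorOneVanishing
import Mathlib.LinearAlgebra.TensorProduct.Tower
import Mathlib.LinearAlgebra.TensorProduct.RightExactness
import Mathlib.LinearAlgebra.DirectSum.Finsupp
import Mathlib.Algebra.Module.Torsion.Basic
import Mathlib.LinearAlgebra.FreeModule.Basic
import Mathlib.LinearAlgebra.Basis.VectorSpace
import Mathlib.RingTheory.Ideal.Maps
import HarnessLib

/-!
# Base change of `Tor₁(R/I, M)` along a ring map when `M/IM` is free (after Stacks 00MM–00MO)

Let `R → R′` be a ring map, `I ⊆ R` an ideal, `M` an `R`-module, `M′ = R′ ⊗_R M`, `I′ = IR′`.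
There is a natural map from `Tor₁^R(R/I, M) = Ker(M ⊗_R I → M)` to
`Tor₁^{R′}(R′/I′, M′) = Ker(M′ ⊗_{R′} I′ → M′)`, induced by `θ : M ⊗_R I → M′ ⊗_{R′} I′`,
`m ⊗ i ↦ (1 ⊗ m) ⊗ i`. The Stacks Project proves (Tags 00MM, 00MN, used in 00MO and in the
"colimit" lemma 00R6) that when `M/IM` is flat over `R/I` the image of `Tor₁^R(R/I, M) ⊗ R′`
generates `Tor₁^{R′}(R′/I′, M′)`. This file PROVES the consequence that is needed to spread
flatness out over a directed system (Tag 00R6), in the elementary language of the `Tor₁`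
toolkit of this directory (`TorOneVanishing.lean`): **if `M/IM` is free over `R/I` (e.g. `R/I` a
field) and `θ` kills `Ker(M ⊗_R I → M)`, then `M′ ⊗_{R′} I′ → M′` is injective**
(`lTensor_injective_baseChange_of_free`), i.e. `Tor₁^{R′}(R′/I′, M′) = 0`.

Proof. `π : R′ ⊗_R (M ⊗_R I) ↠ M′ ⊗_{R′} I′` (`r′ ⊗ m ⊗ i ↦ (r′ ⊗ m) ⊗ i`) satisfies
`(M′ ⊗ I′ → M′) ∘ π = R′ ⊗ (M ⊗ I → M)`, so `Ker(M′ ⊗ I′ → M′) = π(Ker(R′ ⊗ (M ⊗ I → M)))`.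
Choose a basis `(b_j)` of `M/IM` with lifts `m_j ∈ M`, `F = ⊕_j R`; the sequence
`⊕_j I → F × IM → M → 0`, `g ↦ (g, −Σ g_j m_j)`, `(x, y) ↦ Σ x_j m_j + y`, is exact (a relation
`Σ x_j m_j ∈ IM` forces all `x_j ∈ I`, by linear independence of the `b_j`) and stays exact
after `R′ ⊗_R −`. Hence an element `w` of `Ker(R′ ⊗ (M ⊗ I → M))` differs from an element of the
image of `R′ ⊗ Ker(M ⊗ I → IM)` — killed by `π` by hypothesis — by `Σ_j (R′ ⊗ χ_j)(ξ_j)` with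
`χ_j(i) = m_j ⊗ i` and `ξ_j ∈ Ker(R′ ⊗ I → R′)`, and `π` kills these too:
`π((R′ ⊗ χ_j)(Σ r′_k ⊗ i_k)) = (1 ⊗ m_j) ⊗ (Σ r′_k i_k) = 0`.

## Main definitions and results

* `mulMapIdeal I : R′ ⊗_R I → IR′` (onto), `baseChangeTor I M = π`, `baseChangeTor_tmul`,
  `baseChangeTor_surjective`, `smulMap`, `smulMap_baseChangeTor` (compatibility with `M ⊗ I → M`);
  `basisLift` and its lemmas (lifting a basis of `M/IM`).
* `lTensor_injective_baseChange_of_free` — the theorem above;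
  `lTensor_injective_baseChange_of_isMaximal` — the case `I` maximal.

## References

* The Stacks Project, Tags 00MM, 00MN, 00MO (Algebra, §10.99 "Flatness criteria over Artinian
  rings" / local criterion variants), 00R6. [StacksProject]
* H. Matsumura, *Commutative Ring Theory* (1986), §22. [Matsumura1987]
-/

universe u u' v

open TensorProduct

namespace Literature.RingTheory.Flat

variable {R : Type u} [CommRing R] {R' : Type u'} [CommRing R'] [Algebra R R'] (I : Ideal R)
  (M : Type v) [AddCommGroup M] [Module R M]

/-! ### The multiplication map `R′ ⊗_R I → IR′` -/

/-- The `R′`-linear map `R′ ⊗_R R → R′`, `r′ ⊗ r ↦ r r′`, composed with `R′ ⊗ I → R′ ⊗ R`.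
[folklore] -/
noncomputable def mulMapIdealAux : R' ⊗[R] ↥I →ₗ[R'] R' :=
  (TensorProduct.AlgebraTensorModule.rid R R' R').toLinearMap ∘ₗ (I.subtype.baseChange R')

/-- `r′ ⊗ i ↦ i r′`. [folklore] -/
@[simp] theorem mulMapIdealAux_tmul (r' : R') (i : ↥I) :
    mulMapIdealAux I (r' ⊗ₜ[R] i) = (i : R) • r' := by
  simp [mulMapIdealAux]

/-- The image of `R′ ⊗ I → R′` lies in `IR′`. [folklore] -/
theorem mulMapIdealAux_mem (t : R' ⊗[R] ↥I) :
    mulMapIdealAux I t ∈ I.map (algebraMap R R') := by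
  induction t using TensorProduct.induction_on with
  | zero => rw [map_zero]; exact Submodule.zero_mem _
  | add x y hx hy => rw [map_add]; exact Submodule.add_mem _ hx hy
  | tmul r' i =>
    rw [mulMapIdealAux_tmul, Algebra.smul_def]
    exact Ideal.mul_mem_right _ _ (Ideal.mem_map_of_mem _ i.2)

/-- **The multiplication map `R′ ⊗_R I → IR′`**, `r′ ⊗ i ↦ i r′`, onto the extended ideal.
[folklore] -/
noncomputable def mulMapIdeal : R' ⊗[R] ↥I →ₗ[R'] ↥(I.map (algebraMap R R')) :=
  LinearMap.codRestrict _ (mulMapIdealAux I) (mulMapIdealAux_mem I)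

/-- `r′ ⊗ i ↦ i r′`, as an element of `R′`. [folklore] -/
@[simp] theorem mulMapIdeal_tmul_coe (r' : R') (i : ↥I) :
    (mulMapIdeal I (r' ⊗ₜ[R] i) : R') = (i : R) • r' := by
  simp [mulMapIdeal]

/-- `R′ ⊗_R I → IR′` is onto (`IR′` is spanned by the image of `I`). [folklore] -/
theorem mulMapIdeal_surjective : Function.Surjective (mulMapIdeal (R' := R') I) := by
  rintro ⟨z, hz⟩
  suffices h : ∃ t : R' ⊗[R] ↥I, mulMapIdealAux I t = z by
    obtain ⟨t, ht⟩ := h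
    exact ⟨t, Subtype.ext ht⟩
  refine Submodule.span_induction (p := fun z _ => ∃ t : R' ⊗[R] ↥I, mulMapIdealAux I t = z)
    ?_ ?_ ?_ ?_ (show z ∈ Ideal.span (algebraMap R R' '' I) from hz)
  · rintro _ ⟨i, hi, rfl⟩
    refine ⟨(1 : R') ⊗ₜ[R] ⟨i, hi⟩, ?_⟩
    rw [mulMapIdealAux_tmul, Algebra.smul_def, mul_one]
  · exact ⟨0, map_zero _⟩
  · rintro x y - - ⟨s, rfl⟩ ⟨t, rfl⟩
    exact ⟨s + t, map_add _ _ _⟩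
  · rintro a x - ⟨t, rfl⟩
    exact ⟨a • t, map_smul _ _ _⟩

/-- An element of `R′ ⊗ I` killed in `R′ ⊗ R` is killed by the multiplication map. [folklore] -/
theorem mulMapIdeal_eq_zero_of_lTensor_eq_zero (t : R' ⊗[R] ↥I)
    (ht : LinearMap.lTensor R' I.subtype t = 0) : mulMapIdeal I t = 0 := by
  apply Subtype.ext
  change mulMapIdealAux I t = 0
  have : (I.subtype.baseChange R') t = 0 := by
    have h := congrFun (LinearMap.baseChange_eq_ltensor (A := R') (f := I.subtype)) t
    rw [h, ht]
  simp [mulMapIdealAux, this]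

/-! ### The comparison map `π : R′ ⊗_R (M ⊗_R I) → M′ ⊗_{R′} I′` -/

/-- **`π : R′ ⊗_R (M ⊗_R I) → (R′ ⊗_R M) ⊗_{R′} IR′`**, `r′ ⊗ (m ⊗ i) ↦ (r′ ⊗ m) ⊗ i`.
[cite: StacksProject, Tag 00MN (proof)] -/
noncomputable def baseChangeTor :
    R' ⊗[R] (M ⊗[R] ↥I) →ₗ[R'] (R' ⊗[R] M) ⊗[R'] ↥(I.map (algebraMap R R')) :=
  LinearMap.lTensor (R' ⊗[R] M) (mulMapIdeal I) ∘ₗ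
    (TensorProduct.AlgebraTensorModule.cancelBaseChange R R' R' (R' ⊗[R] M) ↥I).symm.toLinearMap ∘ₗ
      (TensorProduct.AlgebraTensorModule.assoc R R R' R' M ↥I).symm.toLinearMap

/-- `π (r′ ⊗ (m ⊗ i)) = (r′ ⊗ m) ⊗ i`. [folklore] -/
@[simp] theorem baseChangeTor_tmul (r' : R') (m : M) (i : ↥I) :
    baseChangeTor I M (r' ⊗ₜ[R] (m ⊗ₜ[R] i)) =
      (r' ⊗ₜ[R] m) ⊗ₜ[R'] mulMapIdeal I ((1 : R') ⊗ₜ[R] i) := by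
  simp [baseChangeTor, TensorProduct.AlgebraTensorModule.cancelBaseChange_symm_tmul]

/-- `π` is onto. [cite: StacksProject, Tag 00MN (proof)] -/
theorem baseChangeTor_surjective : Function.Surjective (baseChangeTor (R' := R') I M) := by
  change Function.Surjective (⇑(LinearMap.lTensor (R' ⊗[R] M) (mulMapIdeal I)) ∘
    (⇑(TensorProduct.AlgebraTensorModule.cancelBaseChange R R' R' (R' ⊗[R] M) ↥I).symm ∘
      ⇑(TensorProduct.AlgebraTensorModule.assoc R R R' R' M ↥I).symm))
  exact (LinearMap.lTensor_surjective _ (mulMapIdeal_surjective I)).comp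
    ((LinearEquiv.surjective _).comp (LinearEquiv.surjective _))

/-- The multiplication map `M ⊗_R I → M`, `m ⊗ i ↦ i m` (`TensorProduct.rid ∘ (M ⊗ I.subtype)`).
[folklore] -/
noncomputable def smulMap : M ⊗[R] ↥I →ₗ[R] M :=
  (TensorProduct.rid R M).toLinearMap ∘ₗ LinearMap.lTensor M I.subtype

/-- `m ⊗ i ↦ i m`. [folklore] -/
@[simp] theorem smulMap_tmul (m : M) (i : ↥I) : smulMap I M (m ⊗ₜ[R] i) = (i : R) • m := by
  simp [smulMap]

/-- `Ker(M ⊗ I → M) = Ker(M ⊗ I → M ⊗ R)`. [folklore] -/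
theorem smulMap_eq_zero_iff (x : M ⊗[R] ↥I) :
    smulMap I M x = 0 ↔ LinearMap.lTensor M I.subtype x = 0 := by
  simp [smulMap]

/-- **Compatibility**: `(M′ ⊗_{R′} I′ → M′) ∘ π = R′ ⊗ (M ⊗_R I → M)`.
[cite: StacksProject, Tag 00MN (proof)] -/
theorem smulMap_baseChangeTor (w : R' ⊗[R] (M ⊗[R] ↥I)) :
    smulMap (I.map (algebraMap R R')) (R' ⊗[R] M) (baseChangeTor I M w) =
      LinearMap.lTensor R' (smulMap I M) w := by
  induction w using TensorProduct.induction_on with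
  | zero => simp
  | add x y hx hy => rw [map_add, map_add, hx, hy, map_add]
  | tmul r' x =>
    induction x using TensorProduct.induction_on with
    | zero => simp
    | add x y hx hy => rw [tmul_add, map_add, map_add, hx, hy, map_add]
    | tmul m i =>
      rw [baseChangeTor_tmul, smulMap_tmul, mulMapIdeal_tmul_coe, LinearMap.lTensor_tmul,
        smulMap_tmul, smul_assoc, one_smul, tmul_smul]

/-! ### Lifting a basis of `M/IM` -/

section Free

variable {ι : Type*} (b : Module.Basis ι (R ⧸ I) (M ⧸ (I • ⊤ : Submodule R M)))

/-- Lifts to `M` of the basis vectors of `M/IM`. [folklore] -/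
noncomputable def basisLift (j : ι) : M :=
  (Submodule.Quotient.mk_surjective (I • ⊤ : Submodule R M) (b j)).choose

/-- The lifts map to the basis vectors. [folklore] -/
theorem basisLift_spec (j : ι) :
    Submodule.Quotient.mk (p := (I • ⊤ : Submodule R M)) (basisLift I M b j) = b j :=
  (Submodule.Quotient.mk_surjective (I • ⊤ : Submodule R M) (b j)).choose_spec

/-- `R`-scalars act on `M/IM` through `R/I`. [folklore] -/
theorem mk_smul_quotient (r : R) (q : M ⧸ (I • ⊤ : Submodule R M)) :
    Ideal.Quotient.mk I r • q = r • q := by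
  induction q using Submodule.Quotient.induction_on with
  | _ m => rfl

/-- The image in `M/IM` of a combination `Σ x_j m_j` of the lifts is `Σ x̄_j b_j`. [folklore] -/
theorem mkQ_linearCombination_basisLift (x : ι →₀ R) :
    Submodule.Quotient.mk (p := (I • ⊤ : Submodule R M))
        (Finsupp.linearCombination R (basisLift I M b) x) =
      Finsupp.linearCombination (R ⧸ I) b (x.mapRange (Ideal.Quotient.mk I) (map_zero _)) := by
  rw [Finsupp.linearCombination_apply, Finsupp.linearCombination_apply,
    Finsupp.sum_mapRange_index (h := fun j (c : R ⧸ I) => c • b j) (fun _ => zero_smul _ _)]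
  rw [← Submodule.mkQ_apply, map_finsuppSum]
  refine Finset.sum_congr rfl fun j _ => ?_
  dsimp only
  rw [map_smul, Submodule.mkQ_apply, basisLift_spec, mk_smul_quotient]

/-- **A relation `Σ x_j m_j ∈ IM` among lifts of a basis of `M/IM` has all `x_j ∈ I`.**
[folklore] -/
theorem mem_of_linearCombination_basisLift_mem (x : ι →₀ R)
    (hx : Finsupp.linearCombination R (basisLift I M b) x ∈ (I • ⊤ : Submodule R M)) (j : ι) :
    x j ∈ I := by
  have h0 : Finsupp.linearCombination (R ⧸ I) b (x.mapRange (Ideal.Quotient.mk I) (map_zero _)) =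
      0 := by
    rw [← mkQ_linearCombination_basisLift, Submodule.Quotient.mk_eq_zero]
    exact hx
  have hinj := (linearIndependent_iff_injective_finsuppLinearCombination.mp b.linearIndependent)
  have hx0 : x.mapRange (Ideal.Quotient.mk I) (map_zero _) = 0 := hinj (by rw [h0, map_zero])
  have := DFunLike.congr_fun hx0 j
  rw [Finsupp.mapRange_apply, Finsupp.zero_apply] at this
  exact Ideal.Quotient.eq_zero_iff_mem.mp this

/-- **`M = Σ R m_j + IM`** for lifts `m_j` of a basis of `M/IM`. [folklore] -/
theorem exists_linearCombination_basisLift_sub_mem (m : M) :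
    ∃ x : ι →₀ R, m - Finsupp.linearCombination R (basisLift I M b) x ∈ (I • ⊤ : Submodule R M) := by
  classical
  let s : R ⧸ I → R := fun c => if c = 0 then 0 else (Ideal.Quotient.mk_surjective c).choose
  have hs : ∀ c, Ideal.Quotient.mk I (s c) = c := fun c => by
    by_cases hc : c = 0
    · simp [s, hc]
    · simp only [s, hc, if_false]
      exact (Ideal.Quotient.mk_surjective c).choose_spec
  let c : ι →₀ R ⧸ I := b.repr (Submodule.Quotient.mk m)
  refine ⟨c.mapRange s (by simp [s]), ?_⟩
  rw [← Submodule.Quotient.mk_eq_zero, Submodule.Quotient.mk_sub, mkQ_linearCombination_basisLift,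
    sub_eq_zero]
  have hcc : (c.mapRange s (by simp [s])).mapRange (Ideal.Quotient.mk I) (map_zero _) = c := by
    ext j
    simp [hs]
  rw [hcc]
  exact (b.linearCombination_repr _).symm

end Free

/-! ### The theorem -/

/-- **Base change of the vanishing of `Tor₁(R/I, M)` when `M/IM` is free** (after The Stacks
Project, Tags 00MM–00MO): let `R → R′` be a ring map, `I ⊆ R` an ideal such that `M/IM` is a
free `R/I`-module, `M′ = R′ ⊗_R M`, `I′ = IR′`. If the comparison map `θ = π(1 ⊗ −) : M ⊗_R I →
M′ ⊗_{R′} I′` kills the kernel of `M ⊗_R I → M` (e.g. because generators of this kernel are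
mapped to zero), then `M′ ⊗_{R′} I′ → M′ ⊗_{R′} R′` is injective, i.e. `Tor₁^{R′}(R′/I′, M′) = 0`.
[cite: StacksProject, Tags 00MN and 00MO (proof)] -/
theorem lTensor_injective_baseChange_of_free
    [Module.Free (R ⧸ I) (M ⧸ (I • ⊤ : Submodule R M))]
    (hθ : ∀ x : M ⊗[R] ↥I, smulMap I M x = 0 → baseChangeTor I M ((1 : R') ⊗ₜ[R] x) = 0) :
    Function.Injective
      (LinearMap.lTensor (R' ⊗[R] M) (I.map (algebraMap R R')).subtype) := by
  classical
  let N : Submodule R M := I • ⊤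
  let π := baseChangeTor (R' := R') I M
  -- the basis of `M/IM` and its lifts
  let b := Module.Free.chooseBasis (R ⧸ I) (M ⧸ N)
  let ι := Module.Free.ChooseBasisIndex (R ⧸ I) (M ⧸ N)
  let m : ι → M := basisLift I M b
  -- `u₁ : M ⊗ I ↠ IM`, with kernel `K`
  have hu₀N : ∀ x : M ⊗[R] ↥I, smulMap I M x ∈ N := fun x => by
    induction x using TensorProduct.induction_on with
    | zero => rw [map_zero]; exact Submodule.zero_mem _
    | add x y hx hy => rw [map_add]; exact Submodule.add_mem _ hx hy
    | tmul m i => rw [smulMap_tmul]; exact Submodule.smul_mem_smul i.2 Submodule.mem_top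
  let u₁ : M ⊗[R] ↥I →ₗ[R] ↥N := (smulMap I M).codRestrict N hu₀N
  have hu₁ : Function.Surjective u₁ := by
    rintro ⟨n, hn⟩
    suffices h : ∃ x : M ⊗[R] ↥I, smulMap I M x = n by
      obtain ⟨x, hx⟩ := h
      exact ⟨x, Subtype.ext hx⟩
    refine Submodule.smul_induction_on hn (fun r hr m _ => ⟨m ⊗ₜ ⟨r, hr⟩, by simp⟩) ?_
    rintro x y ⟨s, rfl⟩ ⟨t, rfl⟩
    exact ⟨s + t, map_add _ _ _⟩
  let K : Submodule R (M ⊗[R] ↥I) := LinearMap.ker u₁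
  have hK : ∀ k ∈ K, smulMap I M k = 0 := fun k hk => by
    have : u₁ k = 0 := hk
    exact congrArg Subtype.val this
  have hexK : Function.Exact K.subtype u₁ := LinearMap.exact_subtype_ker_map u₁
  -- the presentation `G = ⊕_j I → F × IM → M → 0`
  let F := ι →₀ R
  let G := ι →₀ ↥I
  let φ : F →ₗ[R] M := Finsupp.linearCombination R m
  let ιG : G →ₗ[R] F := Finsupp.mapRange.linearMap I.subtype
  have hψj : ∀ (j : ι) (i : ↥I), (i : R) • m j ∈ N := fun j i =>
    Submodule.smul_mem_smul i.2 Submodule.mem_top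
  let ψj : ι → (↥I →ₗ[R] ↥N) := fun j =>
    ((LinearMap.toSpanSingleton R M (m j)) ∘ₗ I.subtype).codRestrict N fun i => hψj j i
  let ψ : G →ₗ[R] ↥N := Finsupp.lsum R ψj
  let α : G →ₗ[R] F × ↥N := ιG.prod (-ψ)
  let β : F × ↥N →ₗ[R] M := φ.coprod N.subtype
  have hφιG : ∀ g : G, φ (ιG g) = (N.subtype (ψ g) : M) := fun g => by
    show Finsupp.linearCombination R m (Finsupp.mapRange.linearMap I.subtype g) =
      (N.subtype (Finsupp.lsum R ψj g) : M)
    rw [Finsupp.mapRange.linearMap_apply, Finsupp.linearCombination_apply, Finsupp.lsum_apply,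
      Finsupp.sum_mapRange_index (h := fun j (r : R) => r • m j) (fun _ => zero_smul _ _),
      map_finsuppSum]
    exact Finset.sum_congr rfl fun j _ => rfl
  have hαβ : Function.Exact α β := by
    intro xy
    obtain ⟨x, y⟩ := xy
    constructor
    · intro h0
      have h0' : φ x + (y : M) = 0 := by simpa [β] using h0
      -- all coefficients of `x` lie in `I`
      have hxN : φ x ∈ N := by
        have : φ x = -(y : M) := eq_neg_of_add_eq_zero_left h0'
        rw [this]
        exact N.neg_mem y.2
      have hxI : ∀ j, x j ∈ I := mem_of_linearCombination_basisLift_mem I M b x hxN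
      let f : R → ↥I := fun r => if h : r ∈ I then ⟨r, h⟩ else 0
      let g : G := x.mapRange f (by simp [f])
      have hg : ιG g = x := by
        ext j
        show ((Finsupp.mapRange.linearMap I.subtype (Finsupp.mapRange f (by simp [f]) x)) j : R) =
          x j
        rw [Finsupp.mapRange.linearMap_apply, Finsupp.mapRange_apply, Finsupp.mapRange_apply]
        show ((if h : x j ∈ I then (⟨x j, h⟩ : ↥I) else 0 : ↥I) : R) = x j
        rw [dif_pos (hxI j)]
      refine ⟨g, ?_⟩
      have hψg : ψ g = -y := by
        apply N.injective_subtype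
        rw [map_neg, ← hφιG, hg]
        exact eq_neg_of_add_eq_zero_left h0'
      simp [α, hg, hψg]
    · rintro ⟨g, hg⟩
      rw [← hg]
      simp [α, β, hφιG]
  have hβ : Function.Surjective β := by
    intro m₀
    obtain ⟨x, hx⟩ := exists_linearCombination_basisLift_sub_mem I M b m₀
    exact ⟨(x, ⟨_, hx⟩), by simp [β, φ, m]⟩
  -- tensor with `R′`
  have hexT := lTensor_exact R' hαβ hβ
  have hexKT := lTensor_exact R' hexK hu₁
  -- start of the chase
  refine (injective_iff_map_eq_zero _).mpr fun z hz => ?_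
  obtain ⟨w, rfl⟩ := baseChangeTor_surjective I M z
  -- `w` is killed by `R′ ⊗ (M ⊗ I → M)`
  have hw : LinearMap.lTensor R' (smulMap I M) w = 0 := by
    rw [← smulMap_baseChangeTor]
    exact (smulMap_eq_zero_iff (I.map (algebraMap R R')) (R' ⊗[R] M) _).mpr hz
  -- `y = (R′ ⊗ u₁) w ∈ R′ ⊗ IM` dies in `R′ ⊗ M`
  let y := LinearMap.lTensor R' u₁ w
  have hy : LinearMap.lTensor R' N.subtype y = 0 := by
    change LinearMap.lTensor R' N.subtype (LinearMap.lTensor R' u₁ w) = 0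
    rw [← LinearMap.comp_apply, ← LinearMap.lTensor_comp]
    exact hw
  -- so `(0, y)` comes from some `ξ ∈ R′ ⊗ G`
  have hy2 : LinearMap.lTensor R' β (LinearMap.lTensor R' (LinearMap.inr R F ↥N) y) = 0 := by
    rw [← LinearMap.comp_apply, ← LinearMap.lTensor_comp, LinearMap.coprod_inr]
    exact hy
  obtain ⟨ξ, hξ⟩ := (hexT _).mp hy2
  have hξ₁ : LinearMap.lTensor R' ιG ξ = 0 := by
    have := congrArg (LinearMap.lTensor R' (LinearMap.fst R F ↥N)) hξ
    rw [← LinearMap.comp_apply, ← LinearMap.lTensor_comp, ← LinearMap.comp_apply,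
      ← LinearMap.lTensor_comp] at this
    simpa [α] using this
  have hξ₂ : LinearMap.lTensor R' ψ ξ = -y := by
    have := congrArg (LinearMap.lTensor R' (LinearMap.snd R F ↥N)) hξ
    rw [← LinearMap.comp_apply, ← LinearMap.lTensor_comp, ← LinearMap.comp_apply,
      ← LinearMap.lTensor_comp] at this
    simp only [α, LinearMap.snd_prod, LinearMap.snd_comp_inr, LinearMap.lTensor_id,
      LinearMap.id_apply, LinearMap.lTensor_neg, LinearMap.neg_apply] at this
    rw [neg_eq_iff_eq_neg] at this
    exact this
  -- `χ : G → M ⊗ I`, `g ↦ Σ m_j ⊗ g_j`, lifts `ψ` along `u₁`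
  let χ : G →ₗ[R] M ⊗[R] ↥I := Finsupp.lsum R fun j => TensorProduct.mk R M ↥I (m j)
  have hχ : u₁ ∘ₗ χ = ψ := by
    refine Finsupp.lhom_ext fun j i => ?_
    apply Subtype.ext
    simp [χ, ψ, ψj, u₁]
  let w₀ := LinearMap.lTensor R' χ ξ
  have hw₀ : LinearMap.lTensor R' u₁ w₀ = -y := by
    change LinearMap.lTensor R' u₁ (LinearMap.lTensor R' χ ξ) = -y
    rw [← LinearMap.comp_apply, ← LinearMap.lTensor_comp, hχ, hξ₂]
  -- `w + w₀` comes from `R′ ⊗ K`, hence is killed by `π`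
  have hsum : LinearMap.lTensor R' u₁ (w + w₀) = 0 := by
    rw [map_add, hw₀]
    exact add_neg_cancel y
  obtain ⟨κ, hκ⟩ := (hexKT _).mp hsum
  have hπK : ∀ κ : R' ⊗[R] ↥K, π (LinearMap.lTensor R' K.subtype κ) = 0 := by
    intro κ
    induction κ using TensorProduct.induction_on with
    | zero => rw [map_zero, map_zero]
    | add x y hx hy => rw [map_add, map_add, hx, hy, add_zero]
    | tmul r' k =>
      rw [LinearMap.lTensor_tmul]
      have h1 : r' ⊗ₜ[R] (K.subtype k) = r' • ((1 : R') ⊗ₜ[R] (K.subtype k)) := by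
        rw [TensorProduct.smul_tmul', smul_eq_mul, mul_one]
      have h2 := hθ (K.subtype k) (hK _ k.2)
      rw [h1, map_smul]
      change r' • baseChangeTor I M ((1 : R') ⊗ₜ[R] K.subtype k) = 0
      rw [h2, smul_zero]
  -- `π` kills `w₀`
  have hπw₀ : π w₀ = 0 := by
    -- components of `ξ` lie in `Ker(R′ ⊗ I → R′ ⊗ R)`
    have hcomp : ∀ j, LinearMap.lTensor R' I.subtype (LinearMap.lTensor R' (Finsupp.lapply j) ξ) =
        0 := fun j => by
      have hmaps : I.subtype ∘ₗ (Finsupp.lapply j : G →ₗ[R] ↥I) =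
          (Finsupp.lapply j : F →ₗ[R] R) ∘ₗ ιG := by
        apply LinearMap.ext
        intro g
        show I.subtype (g j) = Finsupp.mapRange I.subtype (map_zero _) g j
        rw [Finsupp.mapRange_apply]
      rw [← LinearMap.comp_apply, ← LinearMap.lTensor_comp, hmaps, LinearMap.lTensor_comp,
        LinearMap.comp_apply, hξ₁, map_zero]
    -- the maps `Ξ j : R′ ⊗ I → M′ ⊗ I′`, `t ↦ (1 ⊗ m_j) ⊗ mulMapIdeal t`
    have hΞ : ∀ (j : ι) (t : R' ⊗[R] ↥I),
        π (LinearMap.lTensor R' χ ((TensorProduct.finsuppRight R R R' ↥I ι).symm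
          (Finsupp.single j t))) = ((1 : R') ⊗ₜ[R] m j) ⊗ₜ[R'] mulMapIdeal I t := by
      intro j t
      induction t using TensorProduct.induction_on with
      | zero => simp
      | add s t hs ht =>
        rw [Finsupp.single_add, map_add, map_add, map_add, hs, ht, map_add, tmul_add]
      | tmul r' i =>
        rw [TensorProduct.finsuppRight_symm_apply_single, LinearMap.lTensor_tmul]
        have hχs : χ (Finsupp.single j i) = m j ⊗ₜ[R] i := by
          show Finsupp.lsum R (fun j => TensorProduct.mk R M ↥I (m j)) (Finsupp.single j i) = _
          rw [Finsupp.lsum_single]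
          rfl
        rw [hχs]
        change baseChangeTor I M (r' ⊗ₜ[R] (m j ⊗ₜ[R] i)) = _
        rw [baseChangeTor_tmul]
        have h1 : r' ⊗ₜ[R] i = r' • ((1 : R') ⊗ₜ[R] i) := by
          rw [TensorProduct.smul_tmul', smul_eq_mul, mul_one]
        rw [h1, map_smul, tmul_smul, TensorProduct.smul_tmul', TensorProduct.smul_tmul',
          smul_eq_mul, mul_one]
    -- decompose `ξ` along the components
    let ξ' := TensorProduct.finsuppRight R R R' ↥I ι ξ
    have hξ' : ξ = ξ'.sum fun j t =>
        (TensorProduct.finsuppRight R R R' ↥I ι).symm (Finsupp.single j t) := by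
      conv_lhs => rw [← (TensorProduct.finsuppRight R R R' ↥I ι).symm_apply_apply ξ]
      change (TensorProduct.finsuppRight R R R' ↥I ι).symm ξ' = _
      conv_lhs => rw [← Finsupp.sum_single ξ']
      rw [map_finsuppSum]
    have hξ'j : ∀ j, ξ' j = LinearMap.lTensor R' (Finsupp.lapply j) ξ := fun j =>
      TensorProduct.finsuppRight_apply ξ j
    change π (LinearMap.lTensor R' χ ξ) = 0
    rw [hξ', map_finsuppSum, map_finsuppSum]
    refine Finset.sum_eq_zero fun j _ => ?_
    dsimp only
    rw [hΞ, mulMapIdeal_eq_zero_of_lTensor_eq_zero I _ (by rw [hξ'j]; exact hcomp j), tmul_zero]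
  -- conclusion
  have h1 : π (w + w₀) = 0 := by rw [← hκ]; exact hπK κ
  have h2 : π w = π (w + w₀) - π w₀ := eq_sub_of_add_eq (map_add π w w₀).symm
  rw [h2, h1, hπw₀, sub_self]

/-- The case of a maximal ideal: `M/𝔪M` is a vector space, hence free.
[cite: StacksProject, Tag 00MO (proof)] -/
theorem lTensor_injective_baseChange_of_isMaximal [I.IsMaximal]
    (hθ : ∀ x : M ⊗[R] ↥I, smulMap I M x = 0 → baseChangeTor I M ((1 : R') ⊗ₜ[R] x) = 0) :
    Function.Injective
      (LinearMap.lTensor (R' ⊗[R] M) (I.map (algebraMap R R')).subtype) := by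
  letI := Ideal.Quotient.field I
  haveI : Module.Free (R ⧸ I) (M ⧸ (I • ⊤ : Submodule R M)) := inferInstance
  exact lTensor_injective_baseChange_of_free I M hθ

end Literature.RingTheory.Flat
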